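import Summits.NavierStokesRegularity.NavierStokesRegularity.Theorems.ExtremiserTransienceNearExtremalTransienceExtremiserLiouvilleConstantSpeedSlidePalinstrophyLineCoercive
import Summits.NavierStokesRegularity.NavierStokesRegularity.Theorems.ExtremiserTransienceNearExtremalTransienceExtremiserLiouvilleConstantSpeedSlideEnstrophyLineLower
import Summits.NavierStokesRegularity.NavierStokesRegularity.Theorems.ExtremiserTransienceNearExtremalTransienceExtremiserLiouvilleConstantSpeedSlideStretchingLineBound
import HarnessLib

/-!
# Crux `ExtremiserTransience.NearExtremalTransience` (stmt-NavierStokesRegularity-21883), line `extremiser_liouville`,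
# stub K1b — THE LAYER INEQUALITY OF R6b (the four lines combined; record §3/§15/§18)

`--supports stmt-NavierStokesRegularity-21883` (helper).  Author: prover seat `ns-el-k1b` (g9).

(INEQ)₃ (`slideInequality_layer`, p738561) reads `S·J ≤ κ⋆²M²(Pal·X_W + Ens·Ĉ₁)`.  Inserting the W′-line (`enstrophyLine_lower`:
`X_W = −(A + 2B + 2C) ≤ −¼∫g′|Dv|²_F`), the Z′-line (`palinstrophyLine_coercive`, p744248: `M²Ĉ₁ ≤ −(M²/4)Σₖ∫g′|D∂ₖv|²_F + 2∫g′|Dv|⁴_F + M²·Err`)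
and the J-line (`stretchingBracket_abs_le`, …SlideStretchingLineBound: `|J| ≤ 128∫g′‖Dv‖³ + 40σ∫|g″|‖Dv‖²`) gives, for the constant-speed jet with
`‖v − c‖ ≤ σ ≤ M/10` on the layer,
```
  (κ⋆²M²/4)·( Pal·∫g′|Dv|²_F + Ens·Σₖ∫g′|D∂ₖv|²_F ) ≤ |S|·(128∫g′‖Dv‖³ + 40σ∫|g″|‖Dv‖²) + κ⋆²·Ens·(2∫g′|Dv|⁴_F + M²·Err)
```
— THE LAYER INEQUALITY: weighted enstrophy and palinstrophy of the layer are controlled by cubic/quartic gradient terms (absorbed via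
`…SlideLayerGradientL4` and Young once `σ(a)` is small) and by `g″/g‴`-weighted lower-order terms.  What then remains of the jet branch of
K1b is the decay bookkeeping in the height `a` (⇒ `windowEnergy_nonpos_of_expDecay` / `_of_quarticDecay`).
* `slideLayerInequality` : the displayed inequality, hypotheses = those of (INEQ)₃ + the layer smallness of `v − c`.

WHAT THIS IS NOT: K1b is NOT proved; nothing here proves NS regularity. [folklore]
-/

noncomputable section

open Set Filter Topology MeasureTheory Metric Function InnerProductSpace
open scoped ENNReal NNReal Topology InnerProductSpace RealInnerProductSpace ContDiff
open Literature.Analysis.FluidPDE Literature.Analysis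

namespace Summit.NavierStokesRegularity.NavierStokesRegularity.Theorems

-- the problem directory repeats the summit name (`NavierStokesRegularity/NavierStokesRegularity`)
set_option linter.dupNamespace false

namespace ExtremiserLiouville

open DepletionLadder.KStar

variable {v : EuclideanSpace ℝ (Fin 3) → EuclideanSpace ℝ (Fin 3)} {c : EuclideanSpace ℝ (Fin 3)} {g : ℝ → ℝ}

/-- **The layer inequality** (the W′-, Z′- and J-lines inserted into (INEQ)₃; notation of the file header). [folklore] -/
theorem slideLayerInequality
    (hv : ContDiff ℝ ∞ v) (hdiv : VectorCalculus.IsDivFree v) {M B : ℝ} (hMpos : 0 < M)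
    (hM : ∀ x, ‖v x‖ = M) (hB : ∀ x, ‖fderiv ℝ v x‖ ≤ B)
    (h1 : ∫⁻ x, ‖iteratedFDeriv ℝ 1 v x‖ₑ ^ 2 < ⊤) (h2 : ∫⁻ x, ‖iteratedFDeriv ℝ 2 v x‖ₑ ^ 2 < ⊤)
    (hatt : |∫ x, ⟪curl v x, fderiv ℝ v x (curl v x)⟫| = (sInf {κ : ℝ | (∀ (v : EuclideanSpace ℝ (Fin 3) → EuclideanSpace ℝ (Fin 3)) (M B : ℝ), ContDiff ℝ (⊤ : ℕ∞) v → Literature.Analysis.FluidPDE.VectorCalculus.IsDivFree v → (∀ x, ‖v x‖ ≤ M) → (∀ x, ‖fderiv ℝ v x‖ ≤ B) → (∫⁻ x, ‖iteratedFDeriv ℝ 0 v x‖ₑ ^ 2 < ⊤) → (∫⁻ x, ‖iteratedFDeriv ℝ 1 v x‖ₑ ^ 2 < ⊤) → (∫⁻ x, ‖iteratedFDeriv ℝ 2 v x‖ₑ ^ 2 < ⊤) → |∫ x, ⟪Literature.Analysis.FluidPDE.curl v x, fderiv ℝ v x (Literature.Analysis.FluidPDE.curl v x)⟫_ℝ|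 ≤ κ * M * Real.sqrt (∫ x, ‖Literature.Analysis.FluidPDE.curl v x‖ ^ 2) * Real.sqrt (∫ x, Literature.Analysis.FluidPDE.frobeniusNormSq (fderiv ℝ (Literature.Analysis.FluidPDE.curl v) x)))}) * M * Real.sqrt (∫ x, ‖curl v x‖ ^ 2) * Real.sqrt (∫ x, frobeniusNormSq (fderiv ℝ (curl v) x)))
    (hc0 : c 0 = 0) (hc1 : c 1 = 0) (hcM : ‖c‖ = M)
    (hg : ContDiff ℝ ∞ g) {T K0 K1 K2 K3 : ℝ} (hT : 0 < T)
    (hK0 : ∀ s, |g s| ≤ K0) (hK1 : ∀ s, |deriv g s| ≤ K1) (hK2 : ∀ s, |deriv (deriv g) s| ≤ K2)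
    (hK3 : ∀ s, |deriv (deriv (deriv g)) s| ≤ K3)
    (hT1 : ∀ s, T ≤ |s| → deriv g s = 0) (hT2 : ∀ s, T ≤ |s| → deriv (deriv g) s = 0)
    (hT3 : ∀ s, T ≤ |s| → deriv (deriv (deriv g)) s = 0)
    (hg0 : ∀ s, 0 ≤ g s) (hγ0 : ∀ s, 0 ≤ deriv g s)
    (hslab : Integrable (fun x => {x : EuclideanSpace ℝ (Fin 3) | |x 2| ≤ T}.indicator (fun x => ‖v x - c‖ ^ 2) x) volume)
    {h₀ : ℝ} (hh₀ : 0 < h₀) (hfar : ∀ x : EuclideanSpace ℝ (Fin 3), |x 2| ≤ T + h₀ → ‖v x - c‖ ^ 2 ≤ 2 * M ^ 2)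
    {σ : ℝ} (hσ0 : 0 ≤ σ) (hσM : 10 * σ ≤ M)
    (hσ1 : ∀ x : EuclideanSpace ℝ (Fin 3), deriv g (x 2) ≠ 0 → ‖v x - c‖ ≤ σ) (hσ2 : ∀ x : EuclideanSpace ℝ (Fin 3), deriv (deriv g) (x 2) ≠ 0 → ‖v x - c‖ ≤ σ) :
    ((sInf {κ : ℝ | (∀ (v : EuclideanSpace ℝ (Fin 3) → EuclideanSpace ℝ (Fin 3)) (M B : ℝ), ContDiff ℝ (⊤ : ℕ∞) v → Literature.Analysis.FluidPDE.VectorCalculus.IsDivFree v → (∀ x, ‖v x‖ ≤ M) → (∀ x, ‖fderiv ℝ v x‖ ≤ B) → (∫⁻ x, ‖iteratedFDeriv ℝ 0 v x‖ₑ ^ 2 < ⊤) → (∫⁻ x, ‖iteratedFDeriv ℝ 1 v x‖ₑ ^ 2 < ⊤) → (∫⁻ x, ‖iteratedFDeriv ℝ 2 v x‖ₑ ^ 2 < ⊤) → |∫ x, ⟪Literature.Analysis.FluidPDE.curl v x, fderiv ℝ v x (Literature.Analysis.FluidPDE.curl v x)⟫_ℝ| ≤ κ * M * Real.sqrt (∫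 x, ‖Literature.Analysis.FluidPDE.curl v x‖ ^ 2) * Real.sqrt (∫ x, Literature.Analysis.FluidPDE.frobeniusNormSq (fderiv ℝ (Literature.Analysis.FluidPDE.curl v) x)))})) ^ 2 * M ^ 2 / 4 *
        ((∫ x, frobeniusNormSq (fderiv ℝ (curl v) x)) * (∫ x : EuclideanSpace ℝ (Fin 3), deriv g (x 2) * frobeniusNormSq (fderiv ℝ v x)) + (∫ x, ‖curl v x‖ ^ 2) * (∫ x : EuclideanSpace ℝ (Fin 3), deriv g (x 2) * ∑ k : Fin 3, frobeniusNormSq (fderiv ℝ (fun z => fderiv ℝ v z (EuclideanSpace.basisFun (Fin 3) ℝ k)) x))) ≤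
      |(∫ x, ⟪curl v x, fderiv ℝ v x (curl v x)⟫)| * (128 * (∫ x : EuclideanSpace ℝ (Fin 3), deriv g (x 2) * ‖fderiv ℝ v x‖ ^ 3) + 40 * σ * ∫ x : EuclideanSpace ℝ (Fin 3), |deriv (deriv g) (x 2)| * ‖fderiv ℝ v x‖ ^ 2) +
        ((sInf {κ : ℝ | (∀ (v : EuclideanSpace ℝ (Fin 3) → EuclideanSpace ℝ (Fin 3)) (M B : ℝ), ContDiff ℝ (⊤ : ℕ∞) v → Literature.Analysis.FluidPDE.VectorCalculus.IsDivFree v → (∀ x, ‖v x‖ ≤ M) → (∀ x, ‖fderiv ℝ v x‖ ≤ B) → (∫⁻ x, ‖iteratedFDeriv ℝ 0 v x‖ₑ ^ 2 < ⊤) → (∫⁻ x, ‖iteratedFDeriv ℝ 1 v x‖ₑ ^ 2 < ⊤) → (∫⁻ x, ‖iteratedFDeriv ℝ 2 v x‖ₑ ^ 2 < ⊤) → |∫ x, ⟪Literature.Analysis.FluidPDE.curl v x, fderiv ℝ v x (Literature.Analysis.FluidPDE.curl v x)⟫_ℝ| ≤ κ * M * Real.sqrt (∫ x, ‖Literature.Analysis.FluidPDE.curl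 v x‖ ^ 2) * Real.sqrt (∫ x, Literature.Analysis.FluidPDE.frobeniusNormSq (fderiv ℝ (Literature.Analysis.FluidPDE.curl v) x)))})) ^ 2 * (∫ x, ‖curl v x‖ ^ 2) * (2 * (∫ x : EuclideanSpace ℝ (Fin 3), deriv g (x 2) * frobeniusNormSq (fderiv ℝ v x) ^ 2) + M ^ 2 * ((1 / 2) * |(∫ x : EuclideanSpace ℝ (Fin 3), deriv (deriv (deriv g)) (x 2) * ∑ k : Fin 3, (fderiv ℝ v x (EuclideanSpace.basisFun (Fin 3) ℝ k) 2) ^ 2)| + (1 / 2) * |(∫ x : EuclideanSpace ℝ (Fin 3), deriv (deriv (deriv g)) (x 2) * ‖curl v x‖ ^ 2)| + |(∫ x : EuclideanSpace ℝ (Fin 3), deriv (deriv (deriv g)) (x 2) * (fderiv ℝ v x (EuclideanSpace.single (2 : Fin 3) (1 : ℝ)) 2) ^ 2)| +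
        |(∫ x : EuclideanSpace ℝ (Fin 3), deriv (deriv (deriv g)) (x 2) * ⟪fderiv ℝ (curl v) x (EuclideanSpace.single (2 : Fin 3) (1 : ℝ)),
          (-(v x - c) 1) • EuclideanSpace.single (0 : Fin 3) (1 : ℝ) + ((v x - c) 0) • EuclideanSpace.single (1 : Fin 3) (1 : ℝ)⟫)| +
        |(∫ x : EuclideanSpace ℝ (Fin 3), deriv (deriv g) (x 2) * ⟪fderiv ℝ (curl v) x (EuclideanSpace.single (2 : Fin 3) (1 : ℝ)),
          fderiv ℝ (fun z : EuclideanSpace ℝ (Fin 3) => (-(v z - c) 1) • EuclideanSpace.single (0 : Fin 3) (1 : ℝ) + ((v z - c) 0) • EuclideanSpace.single (1 : Fin 3) (1 : ℝ)) x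
            (EuclideanSpace.single (2 : Fin 3) (1 : ℝ))⟫)| +
        |(∫ x : EuclideanSpace ℝ (Fin 3), ∑ i : Fin 3, deriv (deriv g) (x 2) * ⟪fderiv ℝ (curl v) x (EuclideanSpace.basisFun (Fin 3) ℝ i),
            fderiv ℝ (fun z : EuclideanSpace ℝ (Fin 3) => (-(v z - c) 1) • EuclideanSpace.single (0 : Fin 3) (1 : ℝ) + ((v z - c) 0) • EuclideanSpace.single (1 : Fin 3) (1 : ℝ)) x
              (EuclideanSpace.basisFun (Fin 3) ℝ i)⟫)| +
        |(∫ x : EuclideanSpace ℝ (Fin 3), deriv (deriv g) (x 2) * (fderiv ℝ (curl v) x (EuclideanSpace.single (2 : Fin 3) (1 : ℝ)) 0 * fderiv ℝ v x (EuclideanSpace.single (1 : Fin 3) (1 : ℝ)) 2 -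
          fderiv ℝ (curl v) x (EuclideanSpace.single (2 : Fin 3) (1 : ℝ)) 1 * fderiv ℝ v x (EuclideanSpace.single (0 : Fin 3) (1 : ℝ)) 2))|)) := by
  -- (INEQ)₃
  have h3 := slideInequality_layer hv hdiv hMpos hM hB h1 h2 hatt hc0 hc1 hcM hg hT hK0 hK1 hK2 hK3 hT1 hT2 hT3 hg0 hγ0 hslab hh₀ hfar
  -- one bound `K` for `g′, g″, g‴`
  have hK1' : ∀ s, |deriv g s| ≤ max K1 (max K2 K3) := fun s => (hK1 s).trans (le_max_left _ _)
  have hK2' : ∀ s, |deriv (deriv g) s| ≤ max K1 (max K2 K3) := fun s => (hK2 s).trans ((le_max_left _ _).trans (le_max_right _ _))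
  have hK3' : ∀ s, |deriv (deriv (deriv g)) s| ≤ max K1 (max K2 K3) := fun s => (hK3 s).trans ((le_max_right _ _).trans (le_max_right _ _))
  have hg1 : ContDiff ℝ (⊤ : ℕ∞) (deriv g) := by simpa using hg.iterate_deriv 1
  have hg2 : ContDiff ℝ (⊤ : ℕ∞) (deriv (deriv g)) := by simpa using hg.iterate_deriv 2
  have hγK : ∀ s, deriv g s ≤ K1 := fun s => (le_abs_self _).trans (hK1 s)
  have hT1' : ∀ s, T < |s| → deriv g s = 0 := fun s hs => hT1 s hs.le
  have hT2' : ∀ s, T < |s| → deriv (deriv g) s = 0 := fun s hs => hT2 s hs.le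
  -- the three lines
  have hW := enstrophyLine_lower (γ := deriv g) hv hdiv hMpos hM hc0 hc1 hcM (hg1.of_le (by exact_mod_cast le_top)) hγ0 hγK hT1' hσM hσ1 h1 hslab
  have hσM2 : 8 * σ ^ 2 ≤ M ^ 2 := by nlinarith
  have hZ := palinstrophyLine_coercive hv hdiv hM hc0 hc1 hcM hB hg hK1' hK2' hK3' hT3 hγ0 hσM2 hσ1 h1 h2 hslab
  have hJ := stretchingBracket_abs_le (γ₁ := deriv g) (γ₂ := deriv (deriv g)) hv hB h1 hg1.continuous hγ0 hγK hg2.continuous hK2 hT2' hslab hσ0 hσ2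
  -- signs
  have hκ : 0 ≤ ((sInf {κ : ℝ | (∀ (v : EuclideanSpace ℝ (Fin 3) → EuclideanSpace ℝ (Fin 3)) (M B : ℝ), ContDiff ℝ (⊤ : ℕ∞) v → Literature.Analysis.FluidPDE.VectorCalculus.IsDivFree v → (∀ x, ‖v x‖ ≤ M) → (∀ x, ‖fderiv ℝ v x‖ ≤ B) → (∫⁻ x, ‖iteratedFDeriv ℝ 0 v x‖ₑ ^ 2 < ⊤) → (∫⁻ x, ‖iteratedFDeriv ℝ 1 v x‖ₑ ^ 2 < ⊤) → (∫⁻ x, ‖iteratedFDeriv ℝ 2 v x‖ₑ ^ 2 < ⊤) → |∫ x, ⟪Literature.Analysis.FluidPDE.curl v x, fderiv ℝ v x (Literature.Analysis.FluidPDE.curl v x)⟫_ℝ| ≤ κ * M * Real.sqrt (∫ x, ‖Literature.Analysis.FluidPDE.curl v x‖ ^ 2) * Real.sqrt (∫ x, Literature.Analysis.FluidPDE.frobeniusNormSq (fderiv ℝ (Literature.Analysis.FluidPDE.curl v) x)))})) ^ 2 := sq_nonneg _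
  have hPal : 0 ≤ (∫ x, frobeniusNormSq (fderiv ℝ (curl v) x)) := integral_nonneg fun x => frobeniusNormSq_nonneg _
  have hEns : 0 ≤ (∫ x, ‖curl v x‖ ^ 2) := integral_nonneg fun x => sq_nonneg _
  have hM2 : 0 ≤ M ^ 2 := sq_nonneg _
  -- monotone combinations
  have hW' : ((sInf {κ : ℝ | (∀ (v : EuclideanSpace ℝ (Fin 3) → EuclideanSpace ℝ (Fin 3)) (M B : ℝ), ContDiff ℝ (⊤ : ℕ∞) v → Literature.Analysis.FluidPDE.VectorCalculus.IsDivFree v → (∀ x, ‖v x‖ ≤ M) → (∀ x, ‖fderiv ℝ v x‖ ≤ B) → (∫⁻ x, ‖iteratedFDeriv ℝ 0 v x‖ₑ ^ 2 < ⊤) → (∫⁻ x, ‖iteratedFDeriv ℝ 1 v x‖ₑ ^ 2 < ⊤) → (∫⁻ x, ‖iteratedFDeriv ℝ 2 v x‖ₑ ^ 2 < ⊤) → |∫ x, ⟪Literature.Analysis.FluidPDE.curl v x, fderiv ℝ v x (Literature.Analysis.FluidPDE.curl v x)⟫_ℝ| ≤ κ * M * Real.sqrt (∫ x, ‖Literature.Analysis.FluidPDE.curl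 v x‖ ^ 2) * Real.sqrt (∫ x, Literature.Analysis.FluidPDE.frobeniusNormSq (fderiv ℝ (Literature.Analysis.FluidPDE.curl v) x)))})) ^ 2 * M ^ 2 * (∫ x, frobeniusNormSq (fderiv ℝ (curl v) x)) * (-((∫ x, deriv g (x 2) *
          ((3 / 2) * (fderiv ℝ v x (EuclideanSpace.single 2 1) 0 ^ 2 + fderiv ℝ v x (EuclideanSpace.single 2 1) 1 ^ 2) +
            (1 / 2) * curl v x 2 ^ 2 -
            (1 / 2) * (fderiv ℝ v x (EuclideanSpace.single 0 1) 2 ^ 2 + fderiv ℝ v x (EuclideanSpace.single 1 1) 2 ^ 2) -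
            (fderiv ℝ v x (EuclideanSpace.single 0 1) 2 * fderiv ℝ v x (EuclideanSpace.single 2 1) 0 +
              fderiv ℝ v x (EuclideanSpace.single 1 1) 2 * fderiv ℝ v x (EuclideanSpace.single 2 1) 1))) +
        2 * (∫ x, deriv g (x 2) * (fderiv ℝ v x (EuclideanSpace.single (2 : Fin 3) (1 : ℝ)) 2) ^ 2) +
        2 * ∫ x, deriv g (x 2) *
          (fderiv ℝ v x (EuclideanSpace.single 0 1) 2 * fderiv ℝ v x (EuclideanSpace.single 2 1) 0 +
            fderiv ℝ v x (EuclideanSpace.single 1 1) 2 * fderiv ℝ v x (EuclideanSpace.single 2 1) 1))) ≤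
      ((sInf {κ : ℝ | (∀ (v : EuclideanSpace ℝ (Fin 3) → EuclideanSpace ℝ (Fin 3)) (M B : ℝ), ContDiff ℝ (⊤ : ℕ∞) v → Literature.Analysis.FluidPDE.VectorCalculus.IsDivFree v → (∀ x, ‖v x‖ ≤ M) → (∀ x, ‖fderiv ℝ v x‖ ≤ B) → (∫⁻ x, ‖iteratedFDeriv ℝ 0 v x‖ₑ ^ 2 < ⊤) → (∫⁻ x, ‖iteratedFDeriv ℝ 1 v x‖ₑ ^ 2 < ⊤) → (∫⁻ x, ‖iteratedFDeriv ℝ 2 v x‖ₑ ^ 2 < ⊤) → |∫ x, ⟪Literature.Analysis.FluidPDE.curl v x, fderiv ℝ v x (Literature.Analysis.FluidPDE.curl v x)⟫_ℝ| ≤ κ * M * Real.sqrt (∫ x, ‖Literature.Analysis.FluidPDE.curl v x‖ ^ 2) * Real.sqrt (∫ x, Literature.Analysis.FluidPDE.frobeniusNormSq (fderiv ℝ (Literature.Analysis.FluidPDE.curl v) x)))})) ^ 2 * M ^ 2 * (∫ x, frobeniusNormSq (fderiv ℝ (curl v) x)) * (-(1 / 4) * (∫ x : EuclideanSpace ℝ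 (Fin 3), deriv g (x 2) * frobeniusNormSq (fderiv ℝ v x))) :=
    mul_le_mul_of_nonneg_left (by linarith [hW]) (mul_nonneg (mul_nonneg hκ hM2) hPal)
  have hZ' : ((sInf {κ : ℝ | (∀ (v : EuclideanSpace ℝ (Fin 3) → EuclideanSpace ℝ (Fin 3)) (M B : ℝ), ContDiff ℝ (⊤ : ℕ∞) v → Literature.Analysis.FluidPDE.VectorCalculus.IsDivFree v → (∀ x, ‖v x‖ ≤ M) → (∀ x, ‖fderiv ℝ v x‖ ≤ B) → (∫⁻ x, ‖iteratedFDeriv ℝ 0 v x‖ₑ ^ 2 < ⊤) → (∫⁻ x, ‖iteratedFDeriv ℝ 1 v x‖ₑ ^ 2 < ⊤) → (∫⁻ x, ‖iteratedFDeriv ℝ 2 v x‖ₑ ^ 2 < ⊤) → |∫ x, ⟪Literature.Analysis.FluidPDE.curl v x, fderiv ℝ v x (Literature.Analysis.FluidPDE.curl v x)⟫_ℝ| ≤ κ * M * Real.sqrt (∫ x, ‖Literature.Analysis.FluidPDE.curl v x‖ ^ 2) * Real.sqrt (∫ x, Literature.Analysis.FluidPDE.frobeniusNormSq (fderiv ℝ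 (Literature.Analysis.FluidPDE.curl v) x)))})) ^ 2 * (∫ x, ‖curl v x‖ ^ 2) * (M ^ 2 * (-((1 / 2) * ∫ x, deriv g (x 2) * frobeniusNormSq (fderiv ℝ (curl v) x)) -
          (∫ x, deriv (deriv g) (x 2) * ⟪fderiv ℝ (curl v) x (EuclideanSpace.single (2 : Fin 3) (1 : ℝ)), curl v x⟫ +
        deriv g (x 2) * ‖fderiv ℝ (curl v) x (EuclideanSpace.single (2 : Fin 3) (1 : ℝ))‖ ^ 2 +
        deriv (deriv (deriv g)) (x 2) * ⟪fderiv ℝ (curl v) x (EuclideanSpace.single (2 : Fin 3) (1 : ℝ)),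
          (-(v x - c) 1) • EuclideanSpace.single (0 : Fin 3) (1 : ℝ) + ((v x - c) 0) • EuclideanSpace.single (1 : Fin 3) (1 : ℝ)⟫ +
        deriv (deriv g) (x 2) * ⟪fderiv ℝ (curl v) x (EuclideanSpace.single (2 : Fin 3) (1 : ℝ)),
          fderiv ℝ (fun z : EuclideanSpace ℝ (Fin 3) =>
            (-(v z - c) 1) • EuclideanSpace.single (0 : Fin 3) (1 : ℝ) + ((v z - c) 0) • EuclideanSpace.single (1 : Fin 3) (1 : ℝ)) x
            (EuclideanSpace.single (2 : Fin 3) (1 : ℝ))⟫ +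
        ∑ i : Fin 3, (deriv (deriv g) (x 2) * ⟪fderiv ℝ (curl v) x (EuclideanSpace.basisFun (Fin 3) ℝ i),
            fderiv ℝ (fun z : EuclideanSpace ℝ (Fin 3) =>
              (-(v z - c) 1) • EuclideanSpace.single (0 : Fin 3) (1 : ℝ) + ((v z - c) 0) • EuclideanSpace.single (1 : Fin 3) (1 : ℝ)) x
              (EuclideanSpace.basisFun (Fin 3) ℝ i)⟫ +
          deriv g (x 2) * ⟪fderiv ℝ (curl v) x (EuclideanSpace.basisFun (Fin 3) ℝ i),
            fderiv ℝ (fun y : EuclideanSpace ℝ (Fin 3) => fderiv ℝ (fun z : EuclideanSpace ℝ (Fin 3) =>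
              (-(v z - c) 1) • EuclideanSpace.single (0 : Fin 3) (1 : ℝ) + ((v z - c) 0) • EuclideanSpace.single (1 : Fin 3) (1 : ℝ)) y
              (EuclideanSpace.basisFun (Fin 3) ℝ i)) x (EuclideanSpace.single (2 : Fin 3) (1 : ℝ))⟫)) +
          ∫ x, deriv (deriv g) (x 2) * (fderiv ℝ (curl v) x (EuclideanSpace.single (2 : Fin 3) (1 : ℝ)) 0 * fderiv ℝ v x (EuclideanSpace.single (1 : Fin 3) (1 : ℝ)) 2 -
          fderiv ℝ (curl v) x (EuclideanSpace.single (2 : Fin 3) (1 : ℝ)) 1 * fderiv ℝ v x (EuclideanSpace.single (0 : Fin 3) (1 : ℝ)) 2) +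
        deriv g (x 2) * ∑ i : Fin 3, (fderiv ℝ (curl v) x (EuclideanSpace.basisFun (Fin 3) ℝ i) 0 *
            fderiv ℝ (fun y => fderiv ℝ v y (EuclideanSpace.single (1 : Fin 3) (1 : ℝ))) x (EuclideanSpace.basisFun (Fin 3) ℝ i) 2 -
          fderiv ℝ (curl v) x (EuclideanSpace.basisFun (Fin 3) ℝ i) 1 *
            fderiv ℝ (fun y => fderiv ℝ v y (EuclideanSpace.single (0 : Fin 3) (1 : ℝ))) x (EuclideanSpace.basisFun (Fin 3) ℝ i) 2))) ≤
      ((sInf {κ : ℝ | (∀ (v : EuclideanSpace ℝ (Fin 3) → EuclideanSpace ℝ (Fin 3)) (M B : ℝ), ContDiff ℝ (⊤ : ℕ∞) v → Literature.Analysis.FluidPDE.VectorCalculus.IsDivFree v → (∀ x, ‖v x‖ ≤ M) → (∀ x, ‖fderiv ℝ v x‖ ≤ B) → (∫⁻ x, ‖iteratedFDeriv ℝ 0 v x‖ₑ ^ 2 < ⊤) → (∫⁻ x, ‖iteratedFDeriv ℝ 1 v x‖ₑ ^ 2 < ⊤) → (∫⁻ x, ‖iteratedFDeriv ℝ 2 v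 x‖ₑ ^ 2 < ⊤) → |∫ x, ⟪Literature.Analysis.FluidPDE.curl v x, fderiv ℝ v x (Literature.Analysis.FluidPDE.curl v x)⟫_ℝ| ≤ κ * M * Real.sqrt (∫ x, ‖Literature.Analysis.FluidPDE.curl v x‖ ^ 2) * Real.sqrt (∫ x, Literature.Analysis.FluidPDE.frobeniusNormSq (fderiv ℝ (Literature.Analysis.FluidPDE.curl v) x)))})) ^ 2 * (∫ x, ‖curl v x‖ ^ 2) * (-(M ^ 2 / 4) * (∫ x : EuclideanSpace ℝ (Fin 3), deriv g (x 2) * ∑ k : Fin 3, frobeniusNormSq (fderiv ℝ (fun z => fderiv ℝ v z (EuclideanSpace.basisFun (Fin 3) ℝ k)) x)) + 2 * (∫ x : EuclideanSpace ℝ (Fin 3), deriv g (x 2) * frobeniusNormSq (fderiv ℝ v x) ^ 2) + M ^ 2 * ((1 / 2) * |(∫ x : EuclideanSpace ℝ (Fin 3), deriv (deriv (deriv g)) (x 2) * ∑ k : Fin 3, (fderiv ℝ v x (EuclideanSpace.basisFun (Fin 3) ℝ k) 2) ^ 2)| + (1 / 2) * |(∫ x : EuclideanSpace ℝ (Fin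 3), deriv (deriv (deriv g)) (x 2) * ‖curl v x‖ ^ 2)| + |(∫ x : EuclideanSpace ℝ (Fin 3), deriv (deriv (deriv g)) (x 2) * (fderiv ℝ v x (EuclideanSpace.single (2 : Fin 3) (1 : ℝ)) 2) ^ 2)| +
        |(∫ x : EuclideanSpace ℝ (Fin 3), deriv (deriv (deriv g)) (x 2) * ⟪fderiv ℝ (curl v) x (EuclideanSpace.single (2 : Fin 3) (1 : ℝ)),
          (-(v x - c) 1) • EuclideanSpace.single (0 : Fin 3) (1 : ℝ) + ((v x - c) 0) • EuclideanSpace.single (1 : Fin 3) (1 : ℝ)⟫)| +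
        |(∫ x : EuclideanSpace ℝ (Fin 3), deriv (deriv g) (x 2) * ⟪fderiv ℝ (curl v) x (EuclideanSpace.single (2 : Fin 3) (1 : ℝ)),
          fderiv ℝ (fun z : EuclideanSpace ℝ (Fin 3) => (-(v z - c) 1) • EuclideanSpace.single (0 : Fin 3) (1 : ℝ) + ((v z - c) 0) • EuclideanSpace.single (1 : Fin 3) (1 : ℝ)) x
            (EuclideanSpace.single (2 : Fin 3) (1 : ℝ))⟫)| +
        |(∫ x : EuclideanSpace ℝ (Fin 3), ∑ i : Fin 3, deriv (deriv g) (x 2) * ⟪fderiv ℝ (curl v) x (EuclideanSpace.basisFun (Fin 3) ℝ i),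
            fderiv ℝ (fun z : EuclideanSpace ℝ (Fin 3) => (-(v z - c) 1) • EuclideanSpace.single (0 : Fin 3) (1 : ℝ) + ((v z - c) 0) • EuclideanSpace.single (1 : Fin 3) (1 : ℝ)) x
              (EuclideanSpace.basisFun (Fin 3) ℝ i)⟫)| +
        |(∫ x : EuclideanSpace ℝ (Fin 3), deriv (deriv g) (x 2) * (fderiv ℝ (curl v) x (EuclideanSpace.single (2 : Fin 3) (1 : ℝ)) 0 * fderiv ℝ v x (EuclideanSpace.single (1 : Fin 3) (1 : ℝ)) 2 -
          fderiv ℝ (curl v) x (EuclideanSpace.single (2 : Fin 3) (1 : ℝ)) 1 * fderiv ℝ v x (EuclideanSpace.single (0 : Fin 3) (1 : ℝ)) 2))|)) :=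
    mul_le_mul_of_nonneg_left (by linarith [hZ]) (mul_nonneg hκ hEns)
  have hJ' : -((∫ x, ⟪curl v x, fderiv ℝ v x (curl v x)⟫) * (-(-(∫ x, deriv g (x 2) * ⟪curl v x, fderiv ℝ v x (curl v x)⟫) +
          (∫ x, deriv g (x 2) *
          (⟪((-2 * fderiv ℝ v x (EuclideanSpace.single (2 : Fin 3) (1 : ℝ)) 1) • EuclideanSpace.single (0 : Fin 3) (1 : ℝ) + (2 * fderiv ℝ v x (EuclideanSpace.single (2 : Fin 3) (1 : ℝ)) 0) • EuclideanSpace.single (1 : Fin 3) (1 : ℝ) + (curl v x 2) • EuclideanSpace.single (2 : Fin 3) (1 : ℝ)), fderiv ℝ v x (curl v x)⟫ +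
            curl v x 2 * ⟪curl v x, fderiv ℝ v x (EuclideanSpace.single (2 : Fin 3) (1 : ℝ))⟫ +
            ⟪curl v x, fderiv ℝ v x (curl v x) - (fderiv ℝ v x (curl v x) 2) • EuclideanSpace.single (2 : Fin 3) (1 : ℝ)⟫ +
            ⟪curl v x, fderiv ℝ v x ((-2 * fderiv ℝ v x (EuclideanSpace.single (2 : Fin 3) (1 : ℝ)) 1) • EuclideanSpace.single (0 : Fin 3) (1 : ℝ) + (2 * fderiv ℝ v x (EuclideanSpace.single (2 : Fin 3) (1 : ℝ)) 0) • EuclideanSpace.single (1 : Fin 3) (1 : ℝ) + (curl v x 2) • EuclideanSpace.single (2 : Fin 3) (1 : ℝ))⟫)) +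
          ∫ x, deriv (deriv g) (x 2) *
          (⟪((-(v x - c) 1) • EuclideanSpace.single (0 : Fin 3) (1 : ℝ) + ((v x - c) 0) • EuclideanSpace.single (1 : Fin 3) (1 : ℝ)), fderiv ℝ v x (curl v x)⟫ +
            curl v x 2 * ⟪curl v x, v x - c - ((v x - c) 2) • EuclideanSpace.single (2 : Fin 3) (1 : ℝ)⟫ +
            ⟪curl v x, fderiv ℝ v x ((-(v x - c) 1) • EuclideanSpace.single (0 : Fin 3) (1 : ℝ) + ((v x - c) 0) • EuclideanSpace.single (1 : Fin 3) (1 : ℝ))⟫)))) ≤ |(∫ x, ⟪curl v x, fderiv ℝ v x (curl v x)⟫)| * (128 * (∫ x : EuclideanSpace ℝ (Fin 3), deriv g (x 2) * ‖fderiv ℝ v x‖ ^ 3) + 40 * σ * ∫ x : EuclideanSpace ℝ (Fin 3), |deriv (deriv g) (x 2)| * ‖fderiv ℝ v x‖ ^ 2) := by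
    refine (neg_le_abs _).trans ?_
    rw [abs_mul]
    exact mul_le_mul_of_nonneg_left hJ (abs_nonneg _)
  linarith [h3, hW', hZ', hJ']

end ExtremiserLiouville

end Summit.NavierStokesRegularity.NavierStokesRegularity.Theorems

end
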